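/-
Copyright (c) 2026 the pub-hodgecm-mathlib formalisation cell (harness21).  Prover seat hodgecm-mathlib-K2Liu-p01 (g8), Track B «K2-LIT»,
#184♮ = hLiu418 = `stmt-HodgeConjecture-24832`; #42S organ S1 ROAD W, F7 `K2LiuLocalSWParityOscillation` (RULINGS «M-158a» (2), «M-158b»; LEAD BATCH #8 (4): SPEC-F7-FrameStep
ab42186030930277 «=», p01 keeps (i-b)(i-c)(ii)(T4)); lemma (i-c): the TRACE-FORM DUALITY behind «`ψ_v(⟪t,x⟫) = 1 ∀ t ∈ 𝔰_Λ` ↔ `G(x) ≡ 0 mod 𝔪^m`» at an UNRAMIFIED place,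
pure algebra over a ring with an unramified involution (the currency of ★ `UnramifiedQuadraticNorm` and ★ F7b-inst).
-/
import Mathlib.Data.Matrix.Basic
import Mathlib.RingTheory.Ideal.Basic
import HarnessLib

/-!
# Crux `HLiu418`, #42S-S1 ROAD W, file (T3-frame-i-c): TRACE-FORM DUALITY FOR AN UNRAMIFIED INVOLUTION —
# `(∀ u, uz + σ(uz) ∈ I) ↔ z ∈ I`, and for hermitian `G`: `(G_ii ∈ I ∀ i) ∧ (∀ i ≠ j, ∀ u, Tr(u·G_ji) ∈ I) ↔ G ∈ M_n(I)`

Cell `hodgecm-mathlib`, crux item hLiu418 = `stmt-HodgeConjecture-24832` (helper lane `--supports … --as helper`, count-neutral).  THEOREMS ONLY (no `def`, no instance,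
no notation, no named-fact hypothesis, no `sorry`).  PURE ALGEBRA: `O` a commutative ring with a ring involution `σ` MOVING SOME ELEMENT BY A UNIT (`σ a − a ∈ Oˣ` —
«unramified»: the currency of ★ `Literature.NumberTheory.LocalFields.UnramifiedQuadraticNorm` and of ★ F7b-inst `K2LiuInertTruncatedCountDVR`; model `O = 𝒪_{E_w}`, `E_w ∕ F_v`
unramified, any residue characteristic), `I` a `σ`-stable ideal (model `𝔪^m`).

WHY (SPEC-F7-FrameStep ab42186030930277 §1).  After ★ (T3a) + ★ (T3-frame-i-a) + ★ (T3-frame-i-b) the set `D` of ★ (T1) is «`∀ t ∈ 𝔰_Λ : τ(tr(H_t G(x))) ∈ 𝔭^{m′}`» with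
`H_t = δ̂𝕋₀t` HERMITIAN and `τ r = r + σ r`; with the boxes `Λ₀ = ϖ^{c₀}(δ̂𝕋₀)⁻¹·L` (L = the τ-dual of `Herm_n(𝒪_E)`: diagonal `2⁻¹·𝒪_F`, off-diagonal `𝒪_E`) the test
matrices are `½ f E_ii` (`τ(½ f G_ii) = f·G_ii`) and `u E_ij + σ(u) E_ji` (`τ`-pairing `u G_ji + σ(u G_ji)`), so «`x ∈ D`» reads «`G_ii ∈ 𝔪^m` and `∀ u, uG_ji + σ(uG_ji) ∈ 𝔪^m`»
— and THIS file turns that into «every entry of `G` lies in `𝔪^m`» = ★ (T3-core)'s condition, with NO dyadic loss: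
* §1 **`mem_of_forall_add_map_mul_mem`** ∕ **`forall_add_map_mul_mem_iff`** — `(∀ u, uz + σ(uz) ∈ I) ↔ z ∈ I`; only `u ∈ {1, a}` are used: from `z + σz ∈ I` and
  `az + σ(a)σ(z) ∈ I`, `(σa − a)·σz = (az + σa σz) − a(z + σz) ∈ I`, so `σ z ∈ I` and `z = σ(σ z) ∈ I` (`det [[1,1],[a,σa]] = σa − a` a unit — the unramified discriminant).
  `two_mul_mem_of_forall` records the PLAIN diagonal test (`u = 1` on a `σ`-fixed `g` only gives `2g ∈ I` — the (S-dyadic) loss the box `L` avoids).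
* §2 **`forall_entry_mem_iff_of_herm`** — for `G` hermitian (`σ (G i j) = G j i`): `((∀ i, G i i ∈ I) ∧ ∀ i j, i ≠ j → ∀ u, u·G j i + σ(u·G j i) ∈ I) ↔ ∀ i j, G i j ∈ I`;
  (the two test families are the traces `tr(H G)` against `H = ½ f E_ii` and `H = u E_ij + σ(u) E_ji`; cf. K2Liu-p08 (g4)'s ★ `K2LiuTraceDualityMatrixBox.trace_single_mul_eq`).
[Serre1979, Ch. III §3–§5 (different and discriminant; unramified ⇔ trace form perfect)] [Jacobowitz1962, §4] [Shimura1997, §13.2].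
HONEST LABEL.  Count-neutral helper; `HC_CM` is proved only modulo the 7 printed citations (2 remaining named inputs: hLiu418 = `stmt-HodgeConjecture-24832`,
h413 = `stmt-HodgeConjecture-24833`) until rung 0 closes.  NOT here: the frame reading (integrality currency on `LocalRing L v`, boxes, `cells_equiv` — K2Liu-p08 (g4) per BATCH #8).

## References
* [Serre1979] J.-P. Serre, *Local Fields*, GTM 67 (1979), Ch. III §3–§5.
* [Jacobowitz1962] R. Jacobowitz, *Hermitian forms over local fields*, Amer. J. Math. 84 (1962), §4.
* [Shimura1997] G. Shimura, *Euler products and Eisenstein series*, CBMS 93 (1997), §13.2.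
-/

set_option autoImplicit false
set_option linter.dupNamespace false -- the mandated namespace repeats `HodgeConjecture.HodgeConjecture`

namespace Summit.HodgeConjecture.HodgeConjecture.Cruxes.HLiu418.K2LiuHermitianTraceDuality

variable {O : Type*} [CommRing O] (σ : O →+* O) (hσ : ∀ x, σ (σ x) = x) {a : O} (ha : IsUnit (σ a - a))
  {I : Ideal O} (hI : ∀ x ∈ I, σ x ∈ I)

/-! ## §1 Rank one: the trace pairing `(u, z) ↦ uz + σ(uz)` is perfect modulo any `σ`-stable ideal -/

/-- the easy direction: `z ∈ I ⇒ uz + σ(uz) ∈ I`. [folklore] -/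
theorem add_map_mul_mem_of_mem (hI : ∀ x ∈ I, σ x ∈ I) {z : O} (hz : z ∈ I) (u : O) : u * z + σ (u * z) ∈ I :=
  I.add_mem (I.mul_mem_left u hz) (hI _ (I.mul_mem_left u hz))

include hσ ha hI in
/-- **THE UNRAMIFIED DUALITY, rank one**: if `z + σ z ∈ I` and `a z + σ(a z) ∈ I` (the tests `u = 1`, `u = a`), then `z ∈ I`:
`(σa − a)·σz = (az + σ(az)) − a·(z + σz) ∈ I` and `σa − a` is a unit. [cite: Serre1979, Ch. III §5] -/
theorem mem_of_add_map_mem_of_add_map_mul_mem {z : O} (h1 : z + σ z ∈ I) (ha' : a * z + σ (a * z) ∈ I) : z ∈ I := by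
  have hθ : (σ a - a) * σ z ∈ I := by
    have e : (σ a - a) * σ z = (a * z + σ (a * z)) - a * (z + σ z) := by rw [map_mul]; ring
    rw [e]
    exact I.sub_mem ha' (I.mul_mem_left a h1)
  have hσz : σ z ∈ I := by
    obtain ⟨u, hu⟩ := ha
    have h := I.mul_mem_left (↑u⁻¹ : O) hθ
    rwa [← mul_assoc, ← hu, Units.inv_mul, one_mul] at h
  have h := hI _ hσz
  rwa [hσ] at h

include hσ ha hI in
/-- **`(∀ u, uz + σ(uz) ∈ I) ↔ z ∈ I`.** [cite: Serre1979, Ch. III §5] [cite: Jacobowitz1962, §4] -/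
theorem forall_add_map_mul_mem_iff (z : O) : (∀ u : O, u * z + σ (u * z) ∈ I) ↔ z ∈ I :=
  ⟨fun h => mem_of_add_map_mem_of_add_map_mul_mem σ hσ ha hI (by simpa using h 1) (h a), fun hz u => add_map_mul_mem_of_mem σ hI hz u⟩

/-- the PLAIN diagonal test on a `σ`-fixed `g` only gives `2g ∈ I` (`g + σ g = 2g`): the (S-dyadic) loss that the dual box `L` (diagonal `2⁻¹𝒪_F`) avoids.
[cite: Serre1979, Ch. III §3] -/
theorem two_mul_mem_of_add_map_mem {g : O} (hg : σ g = g) (h : g + σ g ∈ I) : 2 * g ∈ I := by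
  rwa [hg, ← two_mul] at h

/-! ## §2 Hermitian matrices: entrywise duality -/

section Herm

variable {n : Type*} [DecidableEq n]

include hσ ha hI in
/-- **ENTRYWISE DUALITY FOR A HERMITIAN MATRIX**: for `G` with `σ (G i j) = G j i`,
`((∀ i, G i i ∈ I) ∧ (∀ i j, i ≠ j → ∀ u, u·G j i + σ(u·G j i) ∈ I)) ↔ ∀ i j, G i j ∈ I`. [cite: Jacobowitz1962, §4] [cite: Shimura1997, §13.2] -/
theorem forall_entry_mem_iff_of_herm {G : Matrix n n O} (hG : ∀ i j, σ (G i j) = G j i) :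
    ((∀ i, G i i ∈ I) ∧ ∀ i j, i ≠ j → ∀ u : O, u * G j i + σ (u * G j i) ∈ I) ↔ ∀ i j, G i j ∈ I := by
  constructor
  · rintro ⟨hdiag, hoff⟩ i j
    by_cases hij : i = j
    · subst hij; exact hdiag i
    · -- `G i j = σ (G j i)` and `G j i ∈ I` by the rank-one duality applied to the tests at `(i, j)`
      have hji : G j i ∈ I := (forall_add_map_mul_mem_iff σ hσ ha hI (G j i)).1 (hoff i j hij)
      have h := hI _ hji
      rwa [hG] at h
  · intro h
    exact ⟨fun i => h i i, fun i j _ u => add_map_mul_mem_of_mem σ hI (h j i) u⟩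

end Herm

end Summit.HodgeConjecture.HodgeConjecture.Cruxes.HLiu418.K2LiuHermitianTraceDuality
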